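import Summits.ValiantsHypothesis.ValiantsHypothesis.Theorems.NewtonUnitEquationsTwoProductsSubmergedDefs

/-!
# K4 `submerged-band-filtration` — the BAND STEP (exact scale separation at the floor letter)

`bandStep_holds : BandStep` (val-idea-36 g0's L1, texts in `…SubmergedDefs`): if `e` is a lowest tail letter for the valid weight `ξ`,
deleting the monomial `X^e` from every tail (`dropLetter`) changes no coefficient of `∏(1+u_j) − ∏(1+v_j)` strictly above the weight of
`e`, hence the strict `ξ`-tops strictly above `e` are the same before and after.  Mechanism: every support point of a product of
factors `1 + (tail)` has weight `≤ 0` for a valid weight, and `(1+u_j) − (1+u°_j) = c_j X^e`; so `∏(1+u_j) − ∏(1+u°_j)` is supported at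
weight `≤ wt ξ e` (induction over the factors with `AC − BD = (A−B)C + B(C−D)`).  Also recorded: the elementary `dropLetter` lemmas
(`coeff_dropLetter`, `support_dropLetter`, `validWeight_dropLetter`, `tailSupport_dropLetter`, `coeff_zero_dropLetter`,
`card_support_dropLetter_le`) that the reduction file consumes.
Helper mode (`--supports stmt-ValiantsHypothesis-5906 --as helper`).  Honest framing: infrastructure for an exact reduction of the
per-cell law to submerged cells; nothing here closes 5906 (`TwoProducts` / `ResidualLawV23` / `PlanarCellBound` OPEN); VP ≠ VNP is NOT
proved.  No instances, no notation, no named facts. [folklore]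
-/

noncomputable section
set_option linter.dupNamespace false

namespace Summit.ValiantsHypothesis.ValiantsHypothesis.Theorems.NewtonUnitEquations.TwoProducts.Submerged
open scoped BigOperators
open MvPolynomial
open Summit.ValiantsHypothesis.ValiantsHypothesis.Theorems.NewtonUnitEquations.TwoProducts.FormalLogLinearisation
open Summit.ValiantsHypothesis.ValiantsHypothesis.Theorems.NewtonUnitEquations.TwoProducts.PlanarCell

variable {m : ℕ}

/-! ## `dropLetter`: elementary lemmas -/

/-- Coefficients of the truncated tail: the `X^e`-coefficient is deleted, all others are unchanged. [folklore] -/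
theorem coeff_dropLetter (u : Fin m → MvPolynomial (Fin 2) ℂ) (e x : Expo) (j : Fin m) :
    coeff x (dropLetter u e j) = if x = e then 0 else coeff x (u j) := by
  classical
  unfold dropLetter
  rw [coeff_sub, coeff_monomial]
  split_ifs with h1 h2 h2
  · subst h2; ring
  · exact absurd h1.symm h2
  · exact absurd h2.symm h1
  · ring

/-- The support of the truncated tail is the old support with `e` erased. [folklore] -/
theorem support_dropLetter (u : Fin m → MvPolynomial (Fin 2) ℂ) (e : Expo) (j : Fin m) :
    (dropLetter u e j).support = (u j).support.erase e := by
  classical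
  ext x
  rw [mem_support_iff, coeff_dropLetter, Finset.mem_erase, mem_support_iff]
  by_cases h : x = e <;> simp [h]

/-- The support of the truncated tail lies in the old support. [folklore] -/
theorem support_dropLetter_subset (u : Fin m → MvPolynomial (Fin 2) ℂ) (e : Expo) (j : Fin m) :
    (dropLetter u e j).support ⊆ (u j).support := by
  rw [support_dropLetter]; exact Finset.erase_subset _ _

/-- Truncation does not increase the number of monomials. [folklore] -/
theorem card_support_dropLetter_le (u : Fin m → MvPolynomial (Fin 2) ℂ) (e : Expo) (j : Fin m) :
    (dropLetter u e j).support.card ≤ (u j).support.card :=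
  Finset.card_le_card (support_dropLetter_subset u e j)

/-- Truncation preserves «no constant term». [folklore] -/
theorem coeff_zero_dropLetter (u : Fin m → MvPolynomial (Fin 2) ℂ) (e : Expo) (hu0 : ∀ j, coeff 0 (u j) = 0)
    (j : Fin m) : coeff 0 (dropLetter u e j) = 0 := by
  rw [coeff_dropLetter]
  split_ifs <;> simp [hu0 j]

/-- A valid weight stays valid after truncation. [folklore] -/
theorem validWeight_dropLetter {u v : Fin m → MvPolynomial (Fin 2) ℂ} {ξ : Fin 2 → ℝ} (h : ValidWeight u v ξ)
    (e : Expo) : ValidWeight (dropLetter u e) (dropLetter v e) ξ :=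
  ⟨fun j x hx => h.1 j x (support_dropLetter_subset u e j hx),
    fun j x hx => h.2 j x (support_dropLetter_subset v e j hx)⟩

/-- The tail support of the truncated family is the old tail support with `e` erased. [folklore] -/
theorem tailSupport_dropLetter (u v : Fin m → MvPolynomial (Fin 2) ℂ) (e : Expo) :
    tailSupport (dropLetter u e) (dropLetter v e) = (tailSupport u v).erase e := by
  classical
  ext x
  simp only [tailSupport, Finset.mem_union, Finset.mem_biUnion, Finset.mem_univ, true_and, Finset.mem_erase,
    support_dropLetter]
  constructor
  · rintro (⟨j, hj⟩ | ⟨j, hj⟩)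
    · exact ⟨hj.1, Or.inl ⟨j, hj.2⟩⟩
    · exact ⟨hj.1, Or.inr ⟨j, hj.2⟩⟩
  · rintro ⟨hne, ⟨j, hj⟩ | ⟨j, hj⟩⟩
    · exact Or.inl ⟨j, hne, hj⟩
    · exact Or.inr ⟨j, hne, hj⟩

/-- `(1 + u_j) − (1 + u°_j) = c_j X^e`. [folklore] -/
theorem one_add_sub_one_add_dropLetter (u : Fin m → MvPolynomial (Fin 2) ℂ) (e : Expo) (j : Fin m) :
    (1 + u j) - (1 + dropLetter u e j) = monomial e (coeff e (u j)) := by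
  unfold dropLetter; ring

/-! ## Supports confined below a weight level -/

/-- Every support point of `P` has weight `≤ w` («`P` lies at or below level `w`»). [folklore] -/
def Below (ξ : Fin 2 → ℝ) (w : ℝ) (P : MvPolynomial (Fin 2) ℂ) : Prop := ∀ x ∈ P.support, wt ξ x ≤ w

/-- `Below` is monotone in the level. [folklore] -/
theorem Below.mono {ξ : Fin 2 → ℝ} {w w' : ℝ} {P : MvPolynomial (Fin 2) ℂ} (h : Below ξ w P) (hw : w ≤ w') :
    Below ξ w' P := fun x hx => (h x hx).trans hw

/-- `Below` is preserved by addition. [folklore] -/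
theorem Below.add {ξ : Fin 2 → ℝ} {w : ℝ} {P Q : MvPolynomial (Fin 2) ℂ} (hP : Below ξ w P) (hQ : Below ξ w Q) :
    Below ξ w (P + Q) := by
  intro x hx
  rcases Finset.mem_union.1 (support_add hx) with h | h
  · exact hP x h
  · exact hQ x h

/-- `Below` is preserved by negation. [folklore] -/
theorem Below.neg {ξ : Fin 2 → ℝ} {w : ℝ} {P : MvPolynomial (Fin 2) ℂ} (hP : Below ξ w P) : Below ξ w (-P) := by
  intro x hx
  rw [support_neg] at hx
  exact hP x hx

/-- `Below` is preserved by subtraction. [folklore] -/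
theorem Below.sub {ξ : Fin 2 → ℝ} {w : ℝ} {P Q : MvPolynomial (Fin 2) ℂ} (hP : Below ξ w P) (hQ : Below ξ w Q) :
    Below ξ w (P - Q) := by
  rw [sub_eq_add_neg]; exact hP.add hQ.neg

/-- Levels add under multiplication. [folklore] -/
theorem Below.mul {ξ : Fin 2 → ℝ} {w₁ w₂ : ℝ} {P Q : MvPolynomial (Fin 2) ℂ} (hP : Below ξ w₁ P) (hQ : Below ξ w₂ Q) :
    Below ξ (w₁ + w₂) (P * Q) := by
  classical
  intro x hx
  obtain ⟨p, hp, q, hq, rfl⟩ := Finset.mem_add.1 (support_mul P Q hx)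
  rw [wt_add]
  exact add_le_add (hP p hp) (hQ q hq)

/-- The constant polynomial `1` lies at level `0`. [folklore] -/
theorem below_one (ξ : Fin 2 → ℝ) : Below ξ 0 (1 : MvPolynomial (Fin 2) ℂ) := by
  classical
  intro x hx
  have hx0 : x = 0 := by
    have h := support_one (R := ℂ) (σ := Fin 2) ▸ hx
    simpa using h
  rw [hx0, wt_zero]

/-- A monomial `c X^e` lies at the level of `e`. [folklore] -/
theorem below_monomial (ξ : Fin 2 → ℝ) (e : Expo) (c : ℂ) : Below ξ (wt ξ e) (monomial e c) := by
  classical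
  intro x hx
  have : x = e := by
    have h := support_monomial_subset hx
    simpa using h
  rw [this]

/-- A factor `1 + (tail)` of a valid-weight instance lies at level `0`. [folklore] -/
theorem below_one_add {ξ : Fin 2 → ℝ} {p : MvPolynomial (Fin 2) ℂ} (hp : ∀ x ∈ p.support, wt ξ x < 0) :
    Below ξ 0 (1 + p) :=
  (below_one ξ).add fun x hx => (hp x hx).le

/-- A product of factors at level `0` lies at level `0`. [folklore] -/
theorem below_prod {ι : Type*} (ξ : Fin 2 → ℝ) (s : Finset ι) (f : ι → MvPolynomial (Fin 2) ℂ)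
    (hf : ∀ i ∈ s, Below ξ 0 (f i)) : Below ξ 0 (∏ i ∈ s, f i) := by
  classical
  induction s using Finset.induction_on with
  | empty => simpa using below_one ξ
  | insert a s ha ih =>
    rw [Finset.prod_insert ha]
    have h := (hf a (Finset.mem_insert_self a s)).mul (ih fun i hi => hf i (Finset.mem_insert_of_mem hi))
    simpa using h

/-- Two products whose factors lie at level `0` and differ, factor by factor, by polynomials at level `≤ w` differ by a polynomial at
level `≤ w` (`AC − BD = (A−B)C + B(C−D)`). [folklore] -/
theorem below_prod_sub_prod {ι : Type*} (ξ : Fin 2 → ℝ) (w : ℝ) (s : Finset ι) (f g : ι → MvPolynomial (Fin 2) ℂ)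
    (hf : ∀ i ∈ s, Below ξ 0 (f i)) (hg : ∀ i ∈ s, Below ξ 0 (g i)) (hfg : ∀ i ∈ s, Below ξ w (f i - g i)) :
    Below ξ w (∏ i ∈ s, f i - ∏ i ∈ s, g i) := by
  classical
  induction s using Finset.induction_on with
  | empty =>
    intro x hx
    simp at hx
  | insert a s ha ih =>
    rw [Finset.prod_insert ha, Finset.prod_insert ha]
    have hA := hf a (Finset.mem_insert_self a s)
    have hB := hg a (Finset.mem_insert_self a s)
    have hAB := hfg a (Finset.mem_insert_self a s)
    have hC := below_prod ξ s f fun i hi => hf i (Finset.mem_insert_of_mem hi)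
    have hCD := ih (fun i hi => hf i (Finset.mem_insert_of_mem hi)) (fun i hi => hg i (Finset.mem_insert_of_mem hi))
      fun i hi => hfg i (Finset.mem_insert_of_mem hi)
    have key : f a * ∏ i ∈ s, f i - g a * ∏ i ∈ s, g i =
        (f a - g a) * ∏ i ∈ s, f i + g a * (∏ i ∈ s, f i - ∏ i ∈ s, g i) := by ring
    rw [key]
    have h1 : Below ξ w ((f a - g a) * ∏ i ∈ s, f i) := by simpa using hAB.mul hC
    have h2 : Below ξ w (g a * (∏ i ∈ s, f i - ∏ i ∈ s, g i)) := by simpa using hB.mul hCD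
    exact h1.add h2

/-- Polynomials that differ by something at level `≤ w` have the same coefficients strictly above `w`. [folklore] -/
theorem coeff_eq_of_below_sub {ξ : Fin 2 → ℝ} {w : ℝ} {P Q : MvPolynomial (Fin 2) ℂ} (h : Below ξ w (P - Q))
    (x : Expo) (hx : w < wt ξ x) : coeff x P = coeff x Q := by
  by_contra hne
  have hmem : x ∈ (P - Q).support := by
    rw [mem_support_iff, coeff_sub]
    exact sub_ne_zero.2 hne
  exact absurd (h x hmem) (not_le.2 hx)

/-- Polynomials with the same coefficients strictly above `w` have the same strict tops strictly above `w`. [folklore] -/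
theorem isStrictTop_support_iff_of_coeff_eq (ξ : Fin 2 → ℝ) (w : ℝ) (P Q : MvPolynomial (Fin 2) ℂ)
    (h : ∀ x : Expo, w < wt ξ x → coeff x P = coeff x Q) (l : Expo) (hl : w < wt ξ l) :
    IsStrictTop ξ (↑P.support) l ↔ IsStrictTop ξ (↑Q.support) l := by
  refine isStrictTop_congr ξ fun p hp => ?_
  simp only [Finset.mem_coe, mem_support_iff]
  rw [h p (lt_of_lt_of_le hl hp)]

/-! ## The band step -/

/-- The product `∏(1+u_j)` and its truncation `∏(1+u°_j)` differ by a polynomial at level `≤ wt ξ e`. [folklore] -/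
theorem below_prod_sub_prod_dropLetter (u : Fin m → MvPolynomial (Fin 2) ℂ) (ξ : Fin 2 → ℝ)
    (hu : ∀ j, ∀ x ∈ (u j).support, wt ξ x < 0) (e : Expo) :
    Below ξ (wt ξ e) (∏ j, (1 + u j) - ∏ j, (1 + dropLetter u e j)) := by
  refine below_prod_sub_prod ξ (wt ξ e) Finset.univ (fun j => 1 + u j) (fun j => 1 + dropLetter u e j)
    (fun j _ => below_one_add (hu j)) (fun j _ => below_one_add fun x hx => hu j x (support_dropLetter_subset u e j hx))
    fun j _ => ?_
  rw [one_add_sub_one_add_dropLetter]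
  exact below_monomial ξ e _

/-- `tailDiff` and its truncation differ by a polynomial at level `≤ wt ξ e`. [folklore] -/
theorem below_tailDiff_sub_tailDiff_dropLetter (u v : Fin m → MvPolynomial (Fin 2) ℂ) (ξ : Fin 2 → ℝ)
    (hξ : ValidWeight u v ξ) (e : Expo) :
    Below ξ (wt ξ e) (tailDiff u v - tailDiff (dropLetter u e) (dropLetter v e)) := by
  have key : tailDiff u v - tailDiff (dropLetter u e) (dropLetter v e) =
      (∏ j, (1 + u j) - ∏ j, (1 + dropLetter u e j)) - (∏ j, (1 + v j) - ∏ j, (1 + dropLetter v e j)) := by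
    unfold tailDiff; ring
  rw [key]
  exact (below_prod_sub_prod_dropLetter u ξ hξ.1 e).sub (below_prod_sub_prod_dropLetter v ξ hξ.2 e)

/-- **Coefficients strictly above the dropped letter are unchanged** (for ANY letter `e`, lowest or not — the floor hypothesis of
`BandStep` is not needed for this half). [folklore] -/
theorem coeff_tailDiff_dropLetter (u v : Fin m → MvPolynomial (Fin 2) ℂ) (ξ : Fin 2 → ℝ) (hξ : ValidWeight u v ξ)
    (e x : Expo) (hx : wt ξ e < wt ξ x) :
    coeff x (tailDiff u v) = coeff x (tailDiff (dropLetter u e) (dropLetter v e)) :=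
  coeff_eq_of_below_sub (below_tailDiff_sub_tailDiff_dropLetter u v ξ hξ e) x hx

/-- **Strict tops strictly above the dropped letter are unchanged.** [folklore] -/
theorem isStrictTop_tailDiff_dropLetter_iff (u v : Fin m → MvPolynomial (Fin 2) ℂ) (ξ : Fin 2 → ℝ)
    (hξ : ValidWeight u v ξ) (e l : Expo) (hl : wt ξ e < wt ξ l) :
    IsStrictTop ξ (↑(tailDiff u v).support) l ↔
      IsStrictTop ξ (↑(tailDiff (dropLetter u e) (dropLetter v e)).support) l :=
  isStrictTop_support_iff_of_coeff_eq ξ (wt ξ e) _ _ (fun x hx => coeff_tailDiff_dropLetter u v ξ hξ e x hx) l hl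

/-- **K4 L1 — THE BAND STEP** (`BandStep`, val-idea-36 g0's text verbatim in `…SubmergedDefs`): exact scale separation at the floor
letter. (The proof uses only the validity of `ξ`; the hypotheses `e ∈ tailSupport u v` and «`e` is lowest» of the registered text are
not needed for the two conclusions and are discharged unused.) [folklore] -/
theorem bandStep_holds : BandStep := by
  intro m u v ξ hξ e _ _
  exact ⟨fun x hx => coeff_tailDiff_dropLetter u v ξ hξ e x hx,
    fun l hl => isStrictTop_tailDiff_dropLetter_iff u v ξ hξ e l hl⟩

end Summit.ValiantsHypothesis.ValiantsHypothesis.Theorems.NewtonUnitEquations.TwoProducts.Submerged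

end
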